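import Summits.HodgeConjecture.HodgeConjecture.Theorems.R90S9SimilCongrMemXiFamily        -- ★ p02 (B3a)+(B3b) glued: `exists_similCongr_memXiFamily` (+ ★ p861492, ★ p861645, ★ p861490)
import Summits.HodgeConjecture.HodgeConjecture.Theorems.R90S9CongrOrbitalMeasureTransport -- ★ p01 (B3d-d2): `isCanonical_transport_cmDatumLocalCongr_symm`, `isMulRightInvariant_congrOrbitalData_of_simil`, `formCongr_toLocalGL_inv_smul`, `isUnit_algebraMap_localRing`
import Summits.HodgeConjecture.HodgeConjecture.Theorems.R90S9SignedClauseCongrTransport  -- ★ p03 (B3d-d3): `charIdentityAtTestSigned_pair_transport_formCongr`, `intCast_clauseSign_mul_clauseSign_eq` (+ ★ engine p861691)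
import Summits.HodgeConjecture.HodgeConjecture.Theorems.R90S9PisEqOfCharIdentityAtTestSigned -- ★ p03 (B3c): `eq_packagePis_of_charIdentityAtTestSigned`, `πs_eq_of_charIdentityAtTestSigned`
import Summits.HodgeConjecture.HodgeConjecture.Theorems.F0P3cStCharTSOfQuasiSplitTransfer    -- ★ (B3d-d4): `isLocalDeltaTransferExists_model_of_formCongr`
import Summits.HodgeConjecture.HodgeConjecture.Theorems.F0P3cDbTEnvelopeTrichotomy           -- ★ (= tree FILE B :1) `MemXiFamily`, `CMCharIdentityPackageTestSigned`, `xiLocalChar`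
import Literature.NumberTheory.Rogawski1990.CharIdentityOnTestFunctionsSignedLemmas          -- ★ (= tree FILE B :3) `CMNonsplitCharIdentityAtTestSigned.πs`
import Literature.NumberTheory.Rogawski1990.FinExplicitTransferFactorConjLeft                -- ★ (= tree FILE B :4)
import Literature.NumberTheory.Rogawski1990.FinExplicitTransferFactorConjRight               -- ★ (= tree FILE B :5)
import Literature.NumberTheory.Automorphic.OrbitalMeasureCanonical                           -- ★ (= tree FILE B :6)
import HarnessLib

/-!
# R90-TF · S9 «InnerForm-13.3.6 (c)» — (B3) `sock_S9_similitudeTransport`: THE DEPENDENCY CUT `similitudeTransport_of_parts` (p04 pattern)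
# «13.3.6 (c) ∕ §14.6 at print's pinned data for `U(Φ₃)` ⟹ the same for `U(H)`, `H = ᵗB̄ (a • Φ₃) B`» modulo ONE input: the SIGNED Q-PACKAGE TRANSPORT `H → Φ₃`

Cell `hodgecm-mathlib`, crux H413 (`stmt-HodgeConjecture-24833`), route of record `HCCMUnconditional`; programme R90-TF, section S9 (base `R90-IF`), seat R90-IF-p02 (g0);
R90-IF-plan RULING JQ-S9-B3 (R90 bus 2026-09-04T16:12:10Z): «p02 TAKES THE B3 CUT».  Helper file, lane `--supports stmt-HodgeConjecture-24833 --as helper`; theorems only.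
HONEST LABEL: HC_CM is proved only modulo the 7 printed citations (2 remaining named inputs: hLiu418 = stmt-HodgeConjecture-24832, h413 = stmt-HodgeConjecture-24833) until
rung 0 closes; this file proves no printed GLOBAL statement: it REDUCES tree FILE B's socket (B3) `SocketSimilitudeTransport` (`Cruxes/H413/Lines/R90_S9_InnerFormTransportB.lean`
e58eb06eba1851d4 :SocketSimilitudeTransport over (B0) `XiMembershipAt` :97–:166, RESTATED TOKEN FOR TOKEN as the conclusion — `XiMembershipAt` δ-unfolded at `(qsForm L, ★ witnesses)`
and at `(H, hH, hHd)`) to ONE hypothesis `hPkg` = (B3d-d3-pkg) «the SIGNED Q-PACKAGE ★ `CMCharIdentityPackageTestSigned` TRANSPORTS from `U(H)` to `U(Φ₃)` along the frames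
`e_v = cmDatumLocalCongr L v B_v⁻¹ _ _` of the similitude» (R90-IF-p03's CENSUS-B3d §0 convention, p01's ★ frame lemmas), whose TYPE is B ED. 3's sub-socket
`SocketSignedPackageTransport` VERBATIM.  Everything else is ★ BY NAME: (B3a)+(B3b) `exists_similCongr_memXiFamily` (p02 ★ p861741 over p01 ★ p861490∕p861645, p02 ★ p861492),
(d1) `rfl`, (d2) p01 ★ p861761, (d4) ★ `isLocalDeltaTransferExists_model_of_formCongr`, the read-back ★ `comap_comap_symm_cmDatumLocalCongr_mul` (p861492) and, for the `πˢ`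
disjunct, p03's ★ uniqueness p861411 + ★ witness transport.
-/

set_option autoImplicit false
-- the mandated namespace repeats the single-problem summit's segment (`HodgeConjecture.HodgeConjecture`)
set_option linter.dupNamespace false

noncomputable section

open NumberField IsDedekindDomain MeasureTheory
open scoped Matrix ComplexOrder

open Literature.NumberTheory Literature.NumberTheory.Automorphic Literature.NumberTheory.Automorphic.UnitaryGroup
open Literature.NumberTheory.Automorphic.IdeleClassGroup
open Literature.NumberTheory.GaloisRepresentations
open Literature.NumberTheory.Rogawski1990
open Summit.HodgeConjecture.HodgeConjecture.Cruxes.H413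

namespace Summit.HodgeConjecture.HodgeConjecture.R90.S9

set_option synthInstance.maxHeartbeats 400000 in
set_option maxHeartbeats 4000000 in
/-- **(B3) DEPENDENCY CUT — `SocketSimilitudeTransport` FROM THE SIGNED Q-PACKAGE TRANSPORT** (p04 pattern; R90-IF-plan RULING JQ-S9-B3, R90 bus 2026-09-04T16:12:10Z).
Hypothesis `hPkg` = (B3d-d3-pkg) «for `ᵗB̄ (a • Φ₃) B = H` (`ā = a ≠ 0`), the SIGNED Q-PACKAGE ★ `CMCharIdentityPackageTestSigned` for `U(H)` at (B0)'s data `(Δ‴_H, m_H, m_G, ν_G, ν_H)`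
(offered together with (B0)'s `hμω`, `hcan`, (H₇)) yields the package for `U(Φ₃)` at the transported data `(Δ‴_{Φ₃}, m_H, E⁻¹_* m_G, E⁻¹_* ν_G, ν_H)` along R90-IF-p03's frames
`E_v = cmDatumLocalCongr L v B_v⁻¹ _ _ : U(Φ₃)_v ≃ₜ* U(H)_v` (★ p861761 `isUnit_algebraMap_localRing`, `formCongr_toLocalGL_inv_smul`), over ANY Borel structures on the model»
— its TYPE is B ED. 3's `def SocketSignedPackageTransport : Prop` VERBATIM.  Conclusion = tree FILE B's `SocketSimilitudeTransport` TOKEN FOR TOKEN (`XiMembershipAt` δ-unfolded at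
`(qsForm L, antidiagOne_isHermitian L 3, isUnit_antidiagOne_det L 3)` and at `(H, hH, hHd)`; δ-certified against tree B e58eb06e at home, both directions `:= h`).
PROOF (all ★ BY NAME): fix the B3 binders and (B0)'s 45 binders at `H`; put `borel` on `U(Φ₃)_v'` and its centraliser quotients; the model data `ν₀ = E⁻¹_* ν_G` (Haar: Mathlib instance;
right invariant ★ `isMulRightInvariant_congrOrbitalData_of_simil`), `m₀ = E⁻¹_* m_G` (canonical ★ `congrOrbitalData_of_simil`, p861761), `Δ₀ = Δ‴_{Φ₃}` (`rfl`), (H₇) on the model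
(★ `isLocalDeltaTransferExists_model_of_formCongr`, `σ a_v = a_v` by ★ `conjLocal_eq_self_of_formCongr_eq_smul_antidiag`), the package `hPkg …`; an automorphic `μ₀` and a discrete
`P₀` of `U(Φ₃)` with `MemXiFamily P₀ … ξ` and the `v`-constituent dictionary along `e′_v = Ad(B_v)` (★ `exists_similCongr_memXiFamily`, p861741 over p861490∕p861645∕p861492); at the
given `v` and H-frame `(T, a′)` the model frame `(B_v·T, a_v⁻¹·a′)` (★ `formCongr_mul_eq_mul_smul_of_formCongr_eq_smul`, ★ `formCongr_toLocalGL_smul`, ★ `formCongr_smul_to_simil`) and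
the class `c₀ = comap e′_v⁻¹ c`, a `v`-constituent of `P₀` by the dictionary; (B0) at `Φ₃` gives the trichotomy for `c₀`; the `πⁿ ∕ π²` disjuncts return by ★
`comap_comap_symm_cmDatumLocalCongr_mul` (p861492); the `πˢ` disjunct by UNIQUENESS of the supercuspidal partner on the model (★ `eq_packagePis_of_charIdentityAtTestSigned`,
p861411) applied to the H-side partner `πˢ_H` carried along `E_v` (★ `charIdentityAtTestSigned_pair_transport_formCongr` + sign constancy ★ `intCast_clauseSign_mul_clauseSign_eq`, p03),
the two identifications `E_v` and `e′_v⁻¹` agreeing on classes (★ `IrrClass.comap_eq_comap_of_forall_eq_conj`, `rfl` on matrices).  Heartbeat caps raised for the 45-binder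
elaboration only (no `decide`, no kernel-heavy step).  [cite: Rogawski1990, §14.2 pp. 232–234; §13.3 Thm. 13.3.6 (c) p. 202; §13.1 Prop. 13.1.3 (d), Prop. 13.1.4 p. 199; §14.6 p. 242; §4.3 (4.3.1) p. 43]
[cite: PlatonovRapinchuk1994, §2.3, §5.1] [cite: LanglandsShelstad1987, §1] -/
theorem similitudeTransport_of_parts
    (hPkg :
      ∀ (L : Type) [Field L] [NumberField L] [IsCMField L] (H : Matrix (Fin 3) (Fin 3) L)
        (hH : (H.map (cmConjRingHom L))ᵀ = H) (hHd : IsUnit H.det) (B : GL (Fin 3) L) (a : L)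
        (haσ : cmConjRingHom L a = a) (ha0 : a ≠ 0) (hB : formCongr (cmConjRingHom L) B (a • qsForm L) = H),
      ∀ [∀ v : HeightOneSpectrum (𝓞 ↥(maximalRealSubfield L)), MeasurableSpace ((cmDatum L 3 H).Local v)]
        [∀ v : HeightOneSpectrum (𝓞 ↥(maximalRealSubfield L)),
          MeasurableSpace ((cmDatum L 2 (Matrix.of fun i j : Fin 2 => if i.val + j.val + 1 = 2 then (1 : L) else 0)).Local v ×
            (cmDatum L 1 (Matrix.of fun i j : Fin 1 => if i.val + j.val + 1 = 1 then (1 : L) else 0)).Local v)]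
        [∀ (v : HeightOneSpectrum (𝓞 ↥(maximalRealSubfield L)))
            (a : ((cmDatum L 2 (Matrix.of fun i j : Fin 2 => if i.val + j.val + 1 = 2 then (1 : L) else 0)).Local v ×
              (cmDatum L 1 (Matrix.of fun i j : Fin 1 => if i.val + j.val + 1 = 1 then (1 : L) else 0)).Local v)),
          MeasurableSpace (((cmDatum L 2 (Matrix.of fun i j : Fin 2 => if i.val + j.val + 1 = 2 then (1 : L) else 0)).Local v ×
              (cmDatum L 1 (Matrix.of fun i j : Fin 1 => if i.val + j.val + 1 = 1 then (1 : L) else 0)).Local v) ⧸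
            Subgroup.centralizer ({a} : Set ((cmDatum L 2 (Matrix.of fun i j : Fin 2 => if i.val + j.val + 1 = 2 then (1 : L) else 0)).Local v ×
              (cmDatum L 1 (Matrix.of fun i j : Fin 1 => if i.val + j.val + 1 = 1 then (1 : L) else 0)).Local v)))]
        [∀ (v : HeightOneSpectrum (𝓞 ↥(maximalRealSubfield L))) (γ : (cmDatum L 3 H).Local v),
          MeasurableSpace ((cmDatum L 3 H).Local v ⧸ Subgroup.centralizer ({γ} : Set ((cmDatum L 3 H).Local v)))]
        [∀ v : HeightOneSpectrum (𝓞 ↥(maximalRealSubfield L)), MeasurableSpace ((cmDatum L 3 (qsForm L)).Local v)]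
        [∀ (v : HeightOneSpectrum (𝓞 ↥(maximalRealSubfield L))) (γ : (cmDatum L 3 (qsForm L)).Local v),
          MeasurableSpace ((cmDatum L 3 (qsForm L)).Local v ⧸ Subgroup.centralizer ({γ} : Set ((cmDatum L 3 (qsForm L)).Local v)))]
        (mH : ∀ v : HeightOneSpectrum (𝓞 ↥(maximalRealSubfield L)),
          OrbitalMeasureFamily ((cmDatum L 2 (Matrix.of fun i j : Fin 2 => if i.val + j.val + 1 = 2 then (1 : L) else 0)).Local v ×
            (cmDatum L 1 (Matrix.of fun i j : Fin 1 => if i.val + j.val + 1 = 1 then (1 : L) else 0)).Local v))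
        (mG : ∀ v : HeightOneSpectrum (𝓞 ↥(maximalRealSubfield L)), OrbitalMeasureFamily ((cmDatum L 3 H).Local v))
        (νG : ∀ v : HeightOneSpectrum (𝓞 ↥(maximalRealSubfield L)), Measure ((cmDatum L 3 H).Local v))
        (νH : ∀ v : HeightOneSpectrum (𝓞 ↥(maximalRealSubfield L)),
          Measure ((cmDatum L 2 (Matrix.of fun i j : Fin 2 => if i.val + j.val + 1 = 2 then (1 : L) else 0)).Local v ×
            (cmDatum L 1 (Matrix.of fun i j : Fin 1 => if i.val + j.val + 1 = 1 then (1 : L) else 0)).Local v))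
        [∀ v : HeightOneSpectrum (𝓞 ↥(maximalRealSubfield L)), BorelSpace ((cmDatum L 3 H).Local v)]
        [∀ v : HeightOneSpectrum (𝓞 ↥(maximalRealSubfield L)),
          BorelSpace ((cmDatum L 2 (Matrix.of fun i j : Fin 2 => if i.val + j.val + 1 = 2 then (1 : L) else 0)).Local v ×
            (cmDatum L 1 (Matrix.of fun i j : Fin 1 => if i.val + j.val + 1 = 1 then (1 : L) else 0)).Local v)]
        [∀ (v : HeightOneSpectrum (𝓞 ↥(maximalRealSubfield L)))
            (a : ((cmDatum L 2 (Matrix.of fun i j : Fin 2 => if i.val + j.val + 1 = 2 then (1 : L) else 0)).Local v ×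
              (cmDatum L 1 (Matrix.of fun i j : Fin 1 => if i.val + j.val + 1 = 1 then (1 : L) else 0)).Local v)),
          BorelSpace (((cmDatum L 2 (Matrix.of fun i j : Fin 2 => if i.val + j.val + 1 = 2 then (1 : L) else 0)).Local v ×
              (cmDatum L 1 (Matrix.of fun i j : Fin 1 => if i.val + j.val + 1 = 1 then (1 : L) else 0)).Local v) ⧸
            Subgroup.centralizer ({a} : Set ((cmDatum L 2 (Matrix.of fun i j : Fin 2 => if i.val + j.val + 1 = 2 then (1 : L) else 0)).Local v ×
              (cmDatum L 1 (Matrix.of fun i j : Fin 1 => if i.val + j.val + 1 = 1 then (1 : L) else 0)).Local v)))]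
        [∀ (v : HeightOneSpectrum (𝓞 ↥(maximalRealSubfield L))) (γ : (cmDatum L 3 H).Local v),
          BorelSpace ((cmDatum L 3 H).Local v ⧸ Subgroup.centralizer ({γ} : Set ((cmDatum L 3 H).Local v)))]
        [∀ v : HeightOneSpectrum (𝓞 ↥(maximalRealSubfield L)), BorelSpace ((cmDatum L 3 (qsForm L)).Local v)]
        [∀ (v : HeightOneSpectrum (𝓞 ↥(maximalRealSubfield L))) (γ : (cmDatum L 3 (qsForm L)).Local v),
          BorelSpace ((cmDatum L 3 (qsForm L)).Local v ⧸ Subgroup.centralizer ({γ} : Set ((cmDatum L 3 (qsForm L)).Local v)))]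
        [∀ v, (νG v).IsHaarMeasure] [∀ v, (νG v).IsMulRightInvariant] [∀ v, (νH v).IsHaarMeasure] [∀ v, (νH v).IsMulRightInvariant],
      ∀ (μω : HeckeCharacter L) (hμu : μω.IsUnitary),
      (∀ x : Literature.NumberTheory.GaloisRepresentations.ideleGroup ↥(maximalRealSubfield L),
        μω (AdeleRing.ideleBaseChange (↥(maximalRealSubfield L)) L x) = quadraticHeckeCharCM L x) →
      (∀ v : HeightOneSpectrum (𝓞 ↥(maximalRealSubfield L)), (mH v).IsCanonical (IsLocalGRegular L v) (νH v) ∧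
        (mG v).IsCanonical (fun γ => IsRegularElt (γ.val : GL (Fin 3) (UnitaryGroup.LocalRing L v))) (νG v)) →
      CMCharIdentityPackageTestSigned L H hH hHd νH νG μω hμu
          (finExplicitCollection L H μω (finExplicitDelta_conj_left_all L H μω) (finExplicitDelta_conj_right_all L H μω)) mH mG →
      (∀ v : HeightOneSpectrum (𝓞 ↥(maximalRealSubfield L)), (∀ w : PlacesOver L v, IsCMField.complexConj L • w.1 = w.1) →
        IsLocalDeltaTransferExists L H v
          ((finExplicitCollection L H μω (finExplicitDelta_conj_left_all L H μω) (finExplicitDelta_conj_right_all L H μω)) v) (mH v) (mG v)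
          Literature.NumberTheory.Rogawski1990.IsLocSmooth Literature.NumberTheory.Rogawski1990.IsLocSmooth) →
      CMCharIdentityPackageTestSigned L (qsForm L) (antidiagOne_isHermitian L 3) (isUnit_antidiagOne_det L 3) νH
        (fun v => (νG v).map
          (cmDatumLocalCongr L v (toLocalGL L v B)⁻¹ (isUnit_algebraMap_localRing L ha0 v) (formCongr_toLocalGL_inv_smul L H B hB v)).symm)
        μω hμu
        (finExplicitCollection L (qsForm L) μω (finExplicitDelta_conj_left_all L (qsForm L) μω) (finExplicitDelta_conj_right_all L (qsForm L) μω)) mH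
        (fun v => (mG v).transport
          (cmDatumLocalCongr L v (toLocalGL L v B)⁻¹ (isUnit_algebraMap_localRing L ha0 v) (formCongr_toLocalGL_inv_smul L H B hB v)).symm.toMulEquiv
          (cmDatumLocalCongr L v (toLocalGL L v B)⁻¹ (isUnit_algebraMap_localRing L ha0 v) (formCongr_toLocalGL_inv_smul L H B hB v)).symm.continuous
          (cmDatumLocalCongr L v (toLocalGL L v B)⁻¹ (isUnit_algebraMap_localRing L ha0 v) (formCongr_toLocalGL_inv_smul L H B hB v)).continuous)) :
    ∀ (L : Type) [Field L] [NumberField L] [IsCMField L] (H : Matrix (Fin 3) (Fin 3) L)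
      (hH : (H.map (cmConjRingHom L))ᵀ = H) (hHd : IsUnit H.det) (B : GL (Fin 3) L) (a : L),
      cmConjRingHom L a = a → a ≠ 0 → formCongr (cmConjRingHom L) B (a • qsForm L) = H →
      (
        ∀ [∀ v : HeightOneSpectrum (𝓞 ↥(maximalRealSubfield L)), MeasurableSpace ((cmDatum L 3 (qsForm L)).Local v)]
          [∀ v : HeightOneSpectrum (𝓞 ↥(maximalRealSubfield L)),
            MeasurableSpace ((cmDatum L 2 (Matrix.of fun i j : Fin 2 => if i.val + j.val + 1 = 2 then (1 : L) else 0)).Local v ×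
              (cmDatum L 1 (Matrix.of fun i j : Fin 1 => if i.val + j.val + 1 = 1 then (1 : L) else 0)).Local v)]
          [∀ (v : HeightOneSpectrum (𝓞 ↥(maximalRealSubfield L)))
              (a : ((cmDatum L 2 (Matrix.of fun i j : Fin 2 => if i.val + j.val + 1 = 2 then (1 : L) else 0)).Local v ×
                (cmDatum L 1 (Matrix.of fun i j : Fin 1 => if i.val + j.val + 1 = 1 then (1 : L) else 0)).Local v)),
            MeasurableSpace (((cmDatum L 2 (Matrix.of fun i j : Fin 2 => if i.val + j.val + 1 = 2 then (1 : L) else 0)).Local v ×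
                (cmDatum L 1 (Matrix.of fun i j : Fin 1 => if i.val + j.val + 1 = 1 then (1 : L) else 0)).Local v) ⧸
              Subgroup.centralizer ({a} : Set ((cmDatum L 2 (Matrix.of fun i j : Fin 2 => if i.val + j.val + 1 = 2 then (1 : L) else 0)).Local v ×
                (cmDatum L 1 (Matrix.of fun i j : Fin 1 => if i.val + j.val + 1 = 1 then (1 : L) else 0)).Local v)))]
          [∀ (v : HeightOneSpectrum (𝓞 ↥(maximalRealSubfield L))) (γ : (cmDatum L 3 (qsForm L)).Local v),
            MeasurableSpace ((cmDatum L 3 (qsForm L)).Local v ⧸ Subgroup.centralizer ({γ} : Set ((cmDatum L 3 (qsForm L)).Local v)))]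
          (Δ : ∀ v : HeightOneSpectrum (𝓞 ↥(maximalRealSubfield L)), LocalTransferFactor L (qsForm L) v)
          (mH : ∀ v : HeightOneSpectrum (𝓞 ↥(maximalRealSubfield L)),
            OrbitalMeasureFamily ((cmDatum L 2 (Matrix.of fun i j : Fin 2 => if i.val + j.val + 1 = 2 then (1 : L) else 0)).Local v ×
              (cmDatum L 1 (Matrix.of fun i j : Fin 1 => if i.val + j.val + 1 = 1 then (1 : L) else 0)).Local v))
          (mG : ∀ v : HeightOneSpectrum (𝓞 ↥(maximalRealSubfield L)), OrbitalMeasureFamily ((cmDatum L 3 (qsForm L)).Local v))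
          (νG : ∀ v : HeightOneSpectrum (𝓞 ↥(maximalRealSubfield L)), Measure ((cmDatum L 3 (qsForm L)).Local v))
          (νH : ∀ v : HeightOneSpectrum (𝓞 ↥(maximalRealSubfield L)),
            Measure ((cmDatum L 2 (Matrix.of fun i j : Fin 2 => if i.val + j.val + 1 = 2 then (1 : L) else 0)).Local v ×
              (cmDatum L 1 (Matrix.of fun i j : Fin 1 => if i.val + j.val + 1 = 1 then (1 : L) else 0)).Local v))
          [∀ v : HeightOneSpectrum (𝓞 ↥(maximalRealSubfield L)), BorelSpace ((cmDatum L 3 (qsForm L)).Local v)]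
          [∀ v : HeightOneSpectrum (𝓞 ↥(maximalRealSubfield L)),
            BorelSpace ((cmDatum L 2 (Matrix.of fun i j : Fin 2 => if i.val + j.val + 1 = 2 then (1 : L) else 0)).Local v ×
              (cmDatum L 1 (Matrix.of fun i j : Fin 1 => if i.val + j.val + 1 = 1 then (1 : L) else 0)).Local v)]
          [∀ (v : HeightOneSpectrum (𝓞 ↥(maximalRealSubfield L)))
              (a : ((cmDatum L 2 (Matrix.of fun i j : Fin 2 => if i.val + j.val + 1 = 2 then (1 : L) else 0)).Local v ×
                (cmDatum L 1 (Matrix.of fun i j : Fin 1 => if i.val + j.val + 1 = 1 then (1 : L) else 0)).Local v)),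
            BorelSpace (((cmDatum L 2 (Matrix.of fun i j : Fin 2 => if i.val + j.val + 1 = 2 then (1 : L) else 0)).Local v ×
                (cmDatum L 1 (Matrix.of fun i j : Fin 1 => if i.val + j.val + 1 = 1 then (1 : L) else 0)).Local v) ⧸
              Subgroup.centralizer ({a} : Set ((cmDatum L 2 (Matrix.of fun i j : Fin 2 => if i.val + j.val + 1 = 2 then (1 : L) else 0)).Local v ×
                (cmDatum L 1 (Matrix.of fun i j : Fin 1 => if i.val + j.val + 1 = 1 then (1 : L) else 0)).Local v)))]
          [∀ (v : HeightOneSpectrum (𝓞 ↥(maximalRealSubfield L))) (γ : (cmDatum L 3 (qsForm L)).Local v),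
            BorelSpace ((cmDatum L 3 (qsForm L)).Local v ⧸ Subgroup.centralizer ({γ} : Set ((cmDatum L 3 (qsForm L)).Local v)))]
          [∀ v, (νG v).IsHaarMeasure] [∀ v, (νG v).IsMulRightInvariant] [∀ v, (νH v).IsHaarMeasure] [∀ v, (νH v).IsMulRightInvariant],
          ∀ (μω : HeckeCharacter L) (hμu : μω.IsUnitary),
          (∀ x : Literature.NumberTheory.GaloisRepresentations.ideleGroup ↥(maximalRealSubfield L),
            μω (AdeleRing.ideleBaseChange (↥(maximalRealSubfield L)) L x) = quadraticHeckeCharCM L x) →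
          Δ = finExplicitCollection L (qsForm L) μω (finExplicitDelta_conj_left_all L (qsForm L) μω) (finExplicitDelta_conj_right_all L (qsForm L) μω) →
          (∀ v : HeightOneSpectrum (𝓞 ↥(maximalRealSubfield L)), (mH v).IsCanonical (IsLocalGRegular L v) (νH v) ∧
            (mG v).IsCanonical (fun γ => IsRegularElt (γ.val : GL (Fin 3) (UnitaryGroup.LocalRing L v))) (νG v)) →
          ∀ (hQS : CMCharIdentityPackageTestSigned L (qsForm L) (antidiagOne_isHermitian L 3) (isUnit_antidiagOne_det L 3) νH νG μω hμu Δ mH mG),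
          (∀ v : HeightOneSpectrum (𝓞 ↥(maximalRealSubfield L)), (∀ w : PlacesOver L v, IsCMField.complexConj L • w.1 = w.1) →
            IsLocalDeltaTransferExists L (qsForm L) v (Δ v) (mH v) (mG v) Literature.NumberTheory.Rogawski1990.IsLocSmooth
              Literature.NumberTheory.Rogawski1990.IsLocSmooth) →
          ∀ (ξ : OneDimAutRepH L)
            (μA : Measure (adelicGroupData (↥(maximalRealSubfield L)) L (IsCMField.complexConj L) 3 (qsForm L)).automorphicQuotient)
            [(adelicGroupData (↥(maximalRealSubfield L)) L (IsCMField.complexConj L) 3 (qsForm L)).IsAutomorphicMeasure μA]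
            (P : DiscreteAutomorphicRep (adelicGroupData (↥(maximalRealSubfield L)) L (IsCMField.complexConj L) 3 (qsForm L)) μA),
            MemXiFamily P (antidiagOne_isHermitian L 3) (isUnit_antidiagOne_det L 3) μω hμu ξ →
            ∀ (v : HeightOneSpectrum (𝓞 ↥(maximalRealSubfield L))) (hns : ∀ w : PlacesOver L v, IsCMField.complexConj L • w.1 = w.1),
            ∀ (T : GL (Fin 3) (LocalRing L v)) (a : LocalRing L v) (ha : IsUnit a)
              (h : formCongr (conjLocal L (IsCMField.complexConj L) v) T ((qsForm L).map (algebraMap L (LocalRing L v))) =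
                a • (Matrix.of fun i j : Fin 3 => if i.val + j.val + 1 = 3 then (1 : L) else 0).map (algebraMap L (LocalRing L v))),
            ∀ [MeasurableSpace (Gqs L v ⧸ Subgroup.center (Gqs L v))] [BorelSpace (Gqs L v ⧸ Subgroup.center (Gqs L v))]
              (μZ : Measure (Gqs L v ⧸ Subgroup.center (Gqs L v))) [μZ.IsHaarMeasure],
            ∀ (π2 πn : IrrClass (Gqs L v)),
            ∀ (hK : KeysCaseTwoLabels L v (μω.semilocalComponent L v) (torusLocalComponent L (IsCMField.complexConj L) v ξ.η)
                (torusLocalComponent L (IsCMField.complexConj L) v ξ.ψ) π2 πn)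
              (hn : ¬ πn.IsSquareIntegrable μZ),
              -- (S-G) «13.3.6 (c) ∕ §14.6 AT PRINT'S PINNED DATA»: every v-constituent of P is πⁿ ∘ e, π² ∘ e, or the πˢ(ξ_v) ∘ e of `hQS`
              ∀ c : IrrClass ((cmDatum L 3 (qsForm L)).Local v),
                (IrrClass.comap (localPiEquiv L (IsCMField.complexConj L) 3 (qsForm L) v) c).IsConstituentOf
                    (P.finRep.smoothPart.toRepresentation.comp (inclPlace (↥(maximalRealSubfield L)) L (IsCMField.complexConj L) 3 (qsForm L) v)) →
                c = IrrClass.comap (cmDatumLocalCongr L v T ha h).symm πn ∨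
                  c = IrrClass.comap (cmDatumLocalCongr L v T ha h).symm π2 ∨
                  c = ((hQS ξ).1 v hns T a ha h μZ π2 πn hK hn).πs) →
      ∀ [∀ v : HeightOneSpectrum (𝓞 ↥(maximalRealSubfield L)), MeasurableSpace ((cmDatum L 3 H).Local v)]
        [∀ v : HeightOneSpectrum (𝓞 ↥(maximalRealSubfield L)),
          MeasurableSpace ((cmDatum L 2 (Matrix.of fun i j : Fin 2 => if i.val + j.val + 1 = 2 then (1 : L) else 0)).Local v ×
            (cmDatum L 1 (Matrix.of fun i j : Fin 1 => if i.val + j.val + 1 = 1 then (1 : L) else 0)).Local v)]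
        [∀ (v : HeightOneSpectrum (𝓞 ↥(maximalRealSubfield L)))
            (a : ((cmDatum L 2 (Matrix.of fun i j : Fin 2 => if i.val + j.val + 1 = 2 then (1 : L) else 0)).Local v ×
              (cmDatum L 1 (Matrix.of fun i j : Fin 1 => if i.val + j.val + 1 = 1 then (1 : L) else 0)).Local v)),
          MeasurableSpace (((cmDatum L 2 (Matrix.of fun i j : Fin 2 => if i.val + j.val + 1 = 2 then (1 : L) else 0)).Local v ×
              (cmDatum L 1 (Matrix.of fun i j : Fin 1 => if i.val + j.val + 1 = 1 then (1 : L) else 0)).Local v) ⧸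
            Subgroup.centralizer ({a} : Set ((cmDatum L 2 (Matrix.of fun i j : Fin 2 => if i.val + j.val + 1 = 2 then (1 : L) else 0)).Local v ×
              (cmDatum L 1 (Matrix.of fun i j : Fin 1 => if i.val + j.val + 1 = 1 then (1 : L) else 0)).Local v)))]
        [∀ (v : HeightOneSpectrum (𝓞 ↥(maximalRealSubfield L))) (γ : (cmDatum L 3 H).Local v),
          MeasurableSpace ((cmDatum L 3 H).Local v ⧸ Subgroup.centralizer ({γ} : Set ((cmDatum L 3 H).Local v)))]
        (Δ : ∀ v : HeightOneSpectrum (𝓞 ↥(maximalRealSubfield L)), LocalTransferFactor L H v)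
        (mH : ∀ v : HeightOneSpectrum (𝓞 ↥(maximalRealSubfield L)),
          OrbitalMeasureFamily ((cmDatum L 2 (Matrix.of fun i j : Fin 2 => if i.val + j.val + 1 = 2 then (1 : L) else 0)).Local v ×
            (cmDatum L 1 (Matrix.of fun i j : Fin 1 => if i.val + j.val + 1 = 1 then (1 : L) else 0)).Local v))
        (mG : ∀ v : HeightOneSpectrum (𝓞 ↥(maximalRealSubfield L)), OrbitalMeasureFamily ((cmDatum L 3 H).Local v))
        (νG : ∀ v : HeightOneSpectrum (𝓞 ↥(maximalRealSubfield L)), Measure ((cmDatum L 3 H).Local v))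
        (νH : ∀ v : HeightOneSpectrum (𝓞 ↥(maximalRealSubfield L)),
          Measure ((cmDatum L 2 (Matrix.of fun i j : Fin 2 => if i.val + j.val + 1 = 2 then (1 : L) else 0)).Local v ×
            (cmDatum L 1 (Matrix.of fun i j : Fin 1 => if i.val + j.val + 1 = 1 then (1 : L) else 0)).Local v))
        [∀ v : HeightOneSpectrum (𝓞 ↥(maximalRealSubfield L)), BorelSpace ((cmDatum L 3 H).Local v)]
        [∀ v : HeightOneSpectrum (𝓞 ↥(maximalRealSubfield L)),
          BorelSpace ((cmDatum L 2 (Matrix.of fun i j : Fin 2 => if i.val + j.val + 1 = 2 then (1 : L) else 0)).Local v ×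
            (cmDatum L 1 (Matrix.of fun i j : Fin 1 => if i.val + j.val + 1 = 1 then (1 : L) else 0)).Local v)]
        [∀ (v : HeightOneSpectrum (𝓞 ↥(maximalRealSubfield L)))
            (a : ((cmDatum L 2 (Matrix.of fun i j : Fin 2 => if i.val + j.val + 1 = 2 then (1 : L) else 0)).Local v ×
              (cmDatum L 1 (Matrix.of fun i j : Fin 1 => if i.val + j.val + 1 = 1 then (1 : L) else 0)).Local v)),
          BorelSpace (((cmDatum L 2 (Matrix.of fun i j : Fin 2 => if i.val + j.val + 1 = 2 then (1 : L) else 0)).Local v ×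
              (cmDatum L 1 (Matrix.of fun i j : Fin 1 => if i.val + j.val + 1 = 1 then (1 : L) else 0)).Local v) ⧸
            Subgroup.centralizer ({a} : Set ((cmDatum L 2 (Matrix.of fun i j : Fin 2 => if i.val + j.val + 1 = 2 then (1 : L) else 0)).Local v ×
              (cmDatum L 1 (Matrix.of fun i j : Fin 1 => if i.val + j.val + 1 = 1 then (1 : L) else 0)).Local v)))]
        [∀ (v : HeightOneSpectrum (𝓞 ↥(maximalRealSubfield L))) (γ : (cmDatum L 3 H).Local v),
          BorelSpace ((cmDatum L 3 H).Local v ⧸ Subgroup.centralizer ({γ} : Set ((cmDatum L 3 H).Local v)))]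
        [∀ v, (νG v).IsHaarMeasure] [∀ v, (νG v).IsMulRightInvariant] [∀ v, (νH v).IsHaarMeasure] [∀ v, (νH v).IsMulRightInvariant],
        ∀ (μω : HeckeCharacter L) (hμu : μω.IsUnitary),
        (∀ x : Literature.NumberTheory.GaloisRepresentations.ideleGroup ↥(maximalRealSubfield L),
          μω (AdeleRing.ideleBaseChange (↥(maximalRealSubfield L)) L x) = quadraticHeckeCharCM L x) →
        Δ = finExplicitCollection L H μω (finExplicitDelta_conj_left_all L H μω) (finExplicitDelta_conj_right_all L H μω) →
        (∀ v : HeightOneSpectrum (𝓞 ↥(maximalRealSubfield L)), (mH v).IsCanonical (IsLocalGRegular L v) (νH v) ∧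
          (mG v).IsCanonical (fun γ => IsRegularElt (γ.val : GL (Fin 3) (UnitaryGroup.LocalRing L v))) (νG v)) →
        ∀ (hQS : CMCharIdentityPackageTestSigned L H hH hHd νH νG μω hμu Δ mH mG),
        (∀ v : HeightOneSpectrum (𝓞 ↥(maximalRealSubfield L)), (∀ w : PlacesOver L v, IsCMField.complexConj L • w.1 = w.1) →
          IsLocalDeltaTransferExists L H v (Δ v) (mH v) (mG v) Literature.NumberTheory.Rogawski1990.IsLocSmooth
            Literature.NumberTheory.Rogawski1990.IsLocSmooth) →
        ∀ (ξ : OneDimAutRepH L)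
          (μA : Measure (adelicGroupData (↥(maximalRealSubfield L)) L (IsCMField.complexConj L) 3 H).automorphicQuotient)
          [(adelicGroupData (↥(maximalRealSubfield L)) L (IsCMField.complexConj L) 3 H).IsAutomorphicMeasure μA]
          (P : DiscreteAutomorphicRep (adelicGroupData (↥(maximalRealSubfield L)) L (IsCMField.complexConj L) 3 H) μA),
          MemXiFamily P hH hHd μω hμu ξ →
          ∀ (v : HeightOneSpectrum (𝓞 ↥(maximalRealSubfield L))) (hns : ∀ w : PlacesOver L v, IsCMField.complexConj L • w.1 = w.1),
          ∀ (T : GL (Fin 3) (LocalRing L v)) (a : LocalRing L v) (ha : IsUnit a)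
            (h : formCongr (conjLocal L (IsCMField.complexConj L) v) T (H.map (algebraMap L (LocalRing L v))) =
              a • (Matrix.of fun i j : Fin 3 => if i.val + j.val + 1 = 3 then (1 : L) else 0).map (algebraMap L (LocalRing L v))),
          ∀ [MeasurableSpace (Gqs L v ⧸ Subgroup.center (Gqs L v))] [BorelSpace (Gqs L v ⧸ Subgroup.center (Gqs L v))]
            (μZ : Measure (Gqs L v ⧸ Subgroup.center (Gqs L v))) [μZ.IsHaarMeasure],
          ∀ (π2 πn : IrrClass (Gqs L v)),
          ∀ (hK : KeysCaseTwoLabels L v (μω.semilocalComponent L v) (torusLocalComponent L (IsCMField.complexConj L) v ξ.η)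
              (torusLocalComponent L (IsCMField.complexConj L) v ξ.ψ) π2 πn)
            (hn : ¬ πn.IsSquareIntegrable μZ),
            -- (S-G) «13.3.6 (c) ∕ §14.6 AT PRINT'S PINNED DATA»: every v-constituent of P is πⁿ ∘ e, π² ∘ e, or the πˢ(ξ_v) ∘ e of `hQS`
            ∀ c : IrrClass ((cmDatum L 3 H).Local v),
              (IrrClass.comap (localPiEquiv L (IsCMField.complexConj L) 3 H v) c).IsConstituentOf
                  (P.finRep.smoothPart.toRepresentation.comp (inclPlace (↥(maximalRealSubfield L)) L (IsCMField.complexConj L) 3 H v)) →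
              c = IrrClass.comap (cmDatumLocalCongr L v T ha h).symm πn ∨
                c = IrrClass.comap (cmDatumLocalCongr L v T ha h).symm π2 ∨
                c = ((hQS ξ).1 v hns T a ha h μZ π2 πn hK hn).πs := by
  intro L _ _ _ H hH hHd B a haσ ha0 hB hqs iM1 iM2 iM3 iM4 Δ mH mG νG νH iB1 iB2 iB3 iB4 iHG iRG iHH iRH μω hμu hμω hΔ hcan hQS hex ξ
    μA iA P hmem v hns T a' ha' h iMZ iBZ μZ iHZ π2 πn hK hn c hc
  subst hΔ
  -- (0) Borel structures on the model side `U(Φ₃)(L⁺_v')` ((B0) at `Φ₃` quantifies over them; we choose `borel`)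
  letI iM₀ : ∀ v' : HeightOneSpectrum (𝓞 ↥(maximalRealSubfield L)), MeasurableSpace ((cmDatum L 3 (qsForm L)).Local v') := fun _ => borel _
  haveI iB₀ : ∀ v' : HeightOneSpectrum (𝓞 ↥(maximalRealSubfield L)), BorelSpace ((cmDatum L 3 (qsForm L)).Local v') := fun _ => ⟨rfl⟩
  letI iMq₀ : ∀ (v' : HeightOneSpectrum (𝓞 ↥(maximalRealSubfield L))) (γ : (cmDatum L 3 (qsForm L)).Local v'),
      MeasurableSpace ((cmDatum L 3 (qsForm L)).Local v' ⧸ Subgroup.centralizer ({γ} : Set ((cmDatum L 3 (qsForm L)).Local v'))) := fun _ _ => borel _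
  haveI iBq₀ : ∀ (v' : HeightOneSpectrum (𝓞 ↥(maximalRealSubfield L))) (γ : (cmDatum L 3 (qsForm L)).Local v'),
      BorelSpace ((cmDatum L 3 (qsForm L)).Local v' ⧸ Subgroup.centralizer ({γ} : Set ((cmDatum L 3 (qsForm L)).Local v'))) := fun _ _ => ⟨rfl⟩
  -- (1) the transported measure data along p03's frames `E_v' = Ad(B_v'⁻¹) : U(Φ₃)_v' ≃ U(H)_v'`: `ν₀ = E⁻¹_* ν_G` (Haar: Mathlib instance; right invariant ★ p861761), `m₀ = E⁻¹_* m_G` canonical (★ p861761)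
  haveI iR₀ : ∀ v' : HeightOneSpectrum (𝓞 ↥(maximalRealSubfield L)), ((νG v').map (cmDatumLocalCongr L v' (toLocalGL L v' B)⁻¹ (isUnit_algebraMap_localRing L ha0 v') (formCongr_toLocalGL_inv_smul L H B hB v')).symm).IsMulRightInvariant :=
    fun v' => isMulRightInvariant_congrOrbitalData_of_simil L H B ha0 hB νG v'
  have hcan₀ : ∀ v' : HeightOneSpectrum (𝓞 ↥(maximalRealSubfield L)), (mH v').IsCanonical (IsLocalGRegular L v') (νH v') ∧
      ((mG v').transport (cmDatumLocalCongr L v' (toLocalGL L v' B)⁻¹ (isUnit_algebraMap_localRing L ha0 v') (formCongr_toLocalGL_inv_smul L H B hB v')).symm.toMulEquiv (cmDatumLocalCongr L v' (toLocalGL L v' B)⁻¹ (isUnit_algebraMap_localRing L ha0 v') (formCongr_toLocalGL_inv_smul L H B hB v')).symm.continuous (cmDatumLocalCongr L v' (toLocalGL L v' B)⁻¹ (isUnit_algebraMap_localRing L ha0 v') (formCongr_toLocalGL_inv_smul L H B hB v')).continuous).IsCanonical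
        (fun γ => IsRegularElt (γ.val : GL (Fin 3) (UnitaryGroup.LocalRing L v'))) ((νG v').map (cmDatumLocalCongr L v' (toLocalGL L v' B)⁻¹ (isUnit_algebraMap_localRing L ha0 v') (formCongr_toLocalGL_inv_smul L H B hB v')).symm) :=
    fun v' => ⟨(hcan v').1, congrOrbitalData_of_simil L H B ha0 hB mG νG (fun w => (hcan w).2)
      (fun w => ((νG w).map (cmDatumLocalCongr L w (toLocalGL L w B)⁻¹ (isUnit_algebraMap_localRing L ha0 w) (formCongr_toLocalGL_inv_smul L H B hB w)).symm)) (fun _ => rfl) v'⟩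
  -- (2) the transported SIGNED Q-PACKAGE (the cut's ONE input) and (H₇) on the model (★ (d4))
  have hQS₀ := hPkg L H hH hHd B a haσ ha0 hB mH mG νG νH μω hμu hμω hcan hQS hex
  have haσv : ∀ v' : HeightOneSpectrum (𝓞 ↥(maximalRealSubfield L)),
      conjLocal L (IsCMField.complexConj L) v' (algebraMap L (LocalRing L v') a) = algebraMap L (LocalRing L v') a := fun v' =>
    conjLocal_eq_self_of_formCongr_eq_smul_antidiag L (N := 3) (by norm_num) hH v' (toLocalGL L v' B)⁻¹ (formCongr_toLocalGL_inv_smul L H B hB v')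
  have hex₀ : ∀ v' : HeightOneSpectrum (𝓞 ↥(maximalRealSubfield L)), (∀ w : PlacesOver L v', IsCMField.complexConj L • w.1 = w.1) →
      IsLocalDeltaTransferExists L (qsForm L) v' ((finExplicitCollection L (qsForm L) μω (finExplicitDelta_conj_left_all L (qsForm L) μω) (finExplicitDelta_conj_right_all L (qsForm L) μω)) v') (mH v') ((mG v').transport (cmDatumLocalCongr L v' (toLocalGL L v' B)⁻¹ (isUnit_algebraMap_localRing L ha0 v') (formCongr_toLocalGL_inv_smul L H B hB v')).symm.toMulEquiv (cmDatumLocalCongr L v' (toLocalGL L v' B)⁻¹ (isUnit_algebraMap_localRing L ha0 v') (formCongr_toLocalGL_inv_smul L H B hB v')).symm.continuous (cmDatumLocalCongr L v' (toLocalGL L v' B)⁻¹ (isUnit_algebraMap_localRing L ha0 v') (formCongr_toLocalGL_inv_smul L H B hB v')).continuous) IsLocSmooth IsLocSmooth := fun v' hns' => by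
    obtain ⟨w⟩ : Nonempty (PlacesOver L v') := inferInstance
    exact F0P3cStCharTSOfQuasiSplit.isLocalDeltaTransferExists_model_of_formCongr L H μω v' w (hns' w) hH hHd.ne_zero (toLocalGL L v' B)⁻¹
      (isUnit_algebraMap_localRing L ha0 v') (haσv v') (formCongr_toLocalGL_inv_smul L H B hB v') (mH v') (mG v') (hex v' hns')
  -- (3) (B3a)+(B3b) ★: an automorphic `μ₀`, a discrete `P₀` of `U(Φ₃)` in the ξ-envelope, and the `v`-constituent dictionary along `e′ = Ad(B_v)`
  have hav' : IsUnit (algebraMap L (LocalRing L v) a⁻¹) := isUnit_algebraMap_localRing L (inv_ne_zero ha0) v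
  have hv' := formCongr_toLocalGL_smul L 3 (qsForm L) H B (formCongr_smul_to_simil (cmConjRingHom L) B ha0 (qsForm L) H hB) v
  refine (exists_similCongr_memXiFamily (antidiagOne_isHermitian L 3) (isUnit_antidiagOne_det L 3) hH hHd B ha0 hB μA P hmem).elim
    fun μ₀ hh => hh.elim fun iA₀ hh => hh.elim fun P₀ hP₀ => ?_
  haveI := iA₀
  -- (4) the Φ₃-frame `(B_v·T, a_v⁻¹·a′)` at `v`, the class `c₀ = c ∘ Ad(B_v)⁻¹`, and (B0) at `Φ₃` for the transported data
  have h₀ := formCongr_mul_eq_mul_smul_of_formCongr_eq_smul L v T (toLocalGL L v B) h hv'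
  have ha₀ : IsUnit (algebraMap L (LocalRing L v) a⁻¹ * a') := hav'.mul ha'
  have hc₀ := (hP₀.2 v (IrrClass.comap (cmDatumLocalCongr L v (toLocalGL L v B) hav' hv').symm c)).2 ((IrrClass.comap_comap_symm (cmDatumLocalCongr L v (toLocalGL L v B) hav' hv') c).symm ▸ hc)
  have key := hqs (finExplicitCollection L (qsForm L) μω (finExplicitDelta_conj_left_all L (qsForm L) μω) (finExplicitDelta_conj_right_all L (qsForm L) μω)) mH
    (fun v' => ((mG v').transport (cmDatumLocalCongr L v' (toLocalGL L v' B)⁻¹ (isUnit_algebraMap_localRing L ha0 v') (formCongr_toLocalGL_inv_smul L H B hB v')).symm.toMulEquiv (cmDatumLocalCongr L v' (toLocalGL L v' B)⁻¹ (isUnit_algebraMap_localRing L ha0 v') (formCongr_toLocalGL_inv_smul L H B hB v')).symm.continuous (cmDatumLocalCongr L v' (toLocalGL L v' B)⁻¹ (isUnit_algebraMap_localRing L ha0 v') (formCongr_toLocalGL_inv_smul L H B hB v')).continuous))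
    (fun v' => ((νG v').map (cmDatumLocalCongr L v' (toLocalGL L v' B)⁻¹ (isUnit_algebraMap_localRing L ha0 v') (formCongr_toLocalGL_inv_smul L H B hB v')).symm))
    νH μω hμu hμω rfl hcan₀ hQS₀ hex₀ ξ μ₀ P₀ hP₀.1 v hns (toLocalGL L v B * T) (algebraMap L (LocalRing L v) a⁻¹ * a') ha₀ h₀ μZ π2 πn hK hn
    (IrrClass.comap (cmDatumLocalCongr L v (toLocalGL L v B) hav' hv').symm c) hc₀
  have hcc : c = IrrClass.comap (cmDatumLocalCongr L v (toLocalGL L v B) hav' hv') (IrrClass.comap (cmDatumLocalCongr L v (toLocalGL L v B) hav' hv').symm c) := (IrrClass.comap_comap_symm _ c).symm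
  -- (5) read the three disjuncts back on `U(H)_v` (★ `comap_comap_symm_cmDatumLocalCongr_mul`; the `πˢ` disjunct by uniqueness on the model, ★ p861411, after ★ p03's witness transport)
  rcases key with h1 | h2 | h3
  · exact Or.inl (hcc.trans (h1.symm ▸ comap_comap_symm_cmDatumLocalCongr_mul L v T (toLocalGL L v B) ha' hav' ha₀ h hv' h₀ πn))
  · exact Or.inr (Or.inl (hcc.trans (h2.symm ▸ comap_comap_symm_cmDatumLocalCongr_mul L v T (toLocalGL L v B) ha' hav' ha₀ h hv' h₀ π2)))
  · refine Or.inr (Or.inr ?_)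
    -- the `πˢ` disjunct: UNIQUENESS of the supercuspidal partner on the MODEL (★ p861411), fed with the H-side partner carried along `Ad(B_v⁻¹)` (★ p03)
    obtain ⟨w⟩ : Nonempty (PlacesOver L v) := inferInstance
    -- the two identifications `U(H)_v → U(Φ₃)_v` (p03's `E_v` and part 1's `e′_v⁻¹`) agree on classes
    have hEE : ∀ y : IrrClass ((cmDatum L 3 H).Local v), IrrClass.comap (cmDatumLocalCongr L v (toLocalGL L v B)⁻¹ (isUnit_algebraMap_localRing L ha0 v) (formCongr_toLocalGL_inv_smul L H B hB v)) y = IrrClass.comap (cmDatumLocalCongr L v (toLocalGL L v B) hav' hv').symm y :=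
      fun y => IrrClass.comap_eq_comap_of_forall_eq_conj _ _ 1 (fun g => by rw [one_mul, inv_one, mul_one]; rfl) y
    -- sign bookkeeping: `χ(a_v) · ε(a′) = ε(a_v⁻¹ a′)` (★ `intCast_clauseSign_mul_clauseSign_eq`; the product frame `(B_v⁻¹·(B_v·T), a_v·(a_v⁻¹·a′)) = (T, a′)`)
    have hprod : algebraMap L (LocalRing L v) a * (algebraMap L (LocalRing L v) a⁻¹ * a') = a' := by
      rw [← mul_assoc, ← map_mul, mul_inv_cancel₀ ha0, map_one, one_mul]
    have hcomp : formCongr (conjLocal L (IsCMField.complexConj L) v) ((toLocalGL L v B)⁻¹ * (toLocalGL L v B * T)) (H.map (algebraMap L (LocalRing L v))) =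
        (algebraMap L (LocalRing L v) a * (algebraMap L (LocalRing L v) a⁻¹ * a')) •
          (Matrix.of fun i j : Fin 3 => if i.val + j.val + 1 = 3 then (1 : L) else 0).map (algebraMap L (LocalRing L v)) := by
      rw [inv_mul_cancel_left, hprod]; exact h
    have hε := intCast_clauseSign_mul_clauseSign_eq L H v hH hns (toLocalGL L v B)⁻¹ (algebraMap L (LocalRing L v) a) (isUnit_algebraMap_localRing L ha0 v)
      (formCongr_toLocalGL_inv_smul L H B hB v) (toLocalGL L v B * T) (algebraMap L (LocalRing L v) a⁻¹ * a') ha₀ h₀ hcomp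
    rw [hprod] at hε
    -- the H-side partner's signed identity, carried to the model (★ `charIdentityAtTestSigned_pair_transport_formCongr`), re-read at the frame `(B_v·T, a_v⁻¹·a′)`
    have htr := charIdentityAtTestSigned_pair_transport_formCongr L H v μω w (hns w) hH hHd (toLocalGL L v B)⁻¹ (isUnit_algebraMap_localRing L ha0 v) (haσv v)
      (formCongr_toLocalGL_inv_smul L H B hB v) (mH v) (mG v) (νG v) (νH v) (ξ.xiLocalChar v) _
      (IrrClass.comap (cmDatumLocalCongr L v T ha' h).symm πn) _ ((hQS ξ).1 v hns T a' ha' h μZ π2 πn hK hn).charIdentityAtTestSigned_πs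
    simp only [hEE, hε, comap_symm_comap_symm_cmDatumLocalCongr L v T (toLocalGL L v B) ha' hav' ha₀ h hv' h₀ πn] at htr
    have huniq := eq_packagePis_of_charIdentityAtTestSigned L (qsForm L) (antidiagOne_isHermitian L 3) (isUnit_antidiagOne_det L 3)
      (fun v' => ((νG v').map (cmDatumLocalCongr L v' (toLocalGL L v' B)⁻¹ (isUnit_algebraMap_localRing L ha0 v') (formCongr_toLocalGL_inv_smul L H B hB v')).symm)) hQS₀ ξ v hns (hex₀ v hns)
      (toLocalGL L v B * T) (algebraMap L (LocalRing L v) a⁻¹ * a') ha₀ h₀ μZ π2 πn hK hn htr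
    -- read back: `c = e′⁻¹_*(πˢ₀) = e′⁻¹_*(e′_*(πˢ_H)) = πˢ_H`
    rw [hcc, h3, ← huniq, IrrClass.comap_comap_symm]

end Summit.HodgeConjecture.HodgeConjecture.R90.S9

end
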